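import Literature.AlgebraicGeometry.Modules.PullbackPushforwardGaloisChart
import Literature.AlgebraicGeometry.Modules.PullbackAffineChart
import HarnessLib

/-!
# The canonical action of self-maps over the base on `f_*f^*M`, and its chart formula `act_x(c · η(m)) = σ_x(c) · η(m)`

Let `f : X → Y` be a morphism of schemes, `τ : K → (X ⟶ X)` self-maps of `X` OVER `Y` (`τ x ≫ f = f`; the setting of
`Modules/PullbackPushforwardTwist` and `Modules/PullbackPushforwardGaloisChart` — e.g. the translations by the kernel of an isogeny, or
the Galois group of a finite étale Galois cover), and `M` an `𝒪_Y`-module. Each `τ x` acts on the `𝒪_Y`-module `f_*f^*M`: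

  `act_x : f_*f^*M → f_*(τ x)_*(τ x)^*f^*M ≅ f_*(τ x)_* f^*M = (τ x ≫ f)_* f^*M = f_*f^*M`

(unit of `(τ x)^* ⊣ (τ x)_*`; the LINEARISATION `(τ x)^*f^*M ≅ (τ x ≫ f)^*M = f^*M`, Mathlib `pullbackComp ∕ pullbackCongr`;
`pushforwardComp ∕ pushforwardCongr`) — the action through which Mumford's descent along a free finite-group quotient `π : X → X∕G`
(*Abelian Varieties*, §7 Thm. 4, §12 Thm. 1: «`π^*` is an equivalence onto `G`-sheaves», so `(π_*π^*M)^G = M`) is phrased. This file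
constructs `act_x` and computes it on sections:

* `pullbackLinearisation f τ hτ M x : (τ x)^* f^*M ≅ f^*M`;
* `twistAction f τ hτ M x : f_*f^*M ⟶ f_*f^*M`;
* **`twistAction_app_smul_unitSection`** — for `c ∈ Γ(f⁻¹V, 𝒪_X)`, `m ∈ Γ(V, M)`: `act_x(c · η(m)) = σ_x(c) · η(m)` with `σ_x = (τ x)♯`
  (`twistRingHom` of `…GaloisChart`) — on an affine chart, where `Γ(f⁻¹V, f^*M) = Γ(f⁻¹V, 𝒪) ⊗ Γ(V, M)`, this says `act_x = σ_x ⊗ 1`;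
* `twistAction_app_unitSection`, **`pullbackUnit_comp_twistAction`** — `η_M ≫ act_x = η_M`: pulled-back sections are invariant.

Everything is proved; no named facts, no `sorry`. Written for Hodge road №4 (crux stmt-HodgeConjecture-26512, lens line N′: the
descent-identity face «`(q_*q^*M)^Ḡ ≅ M`» of the object residue (N-U), director-hodge (M5)-lite); the invariants statement is the sequel.

## References

* D. Mumford, *Abelian Varieties* (1970), §7 Thm. 4 (p. 72), §12 Thm. 1 (p. 111). [MumfordAV1970]
* R. Hartshorne, *Algebraic Geometry*, GTM 52 (1977), II.5 (p. 110: `f^*`, `f_*`, adjunction). [Hartshorne1977]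
-/

noncomputable section

-- `TopCat.Presheaf`/`Scheme.Modules` are not reducible (as in Mathlib's `AlgebraicGeometry/Modules/Sheaf.lean`).
set_option backward.isDefEq.respectTransparency false

open CategoryTheory AlgebraicGeometry TopologicalSpace Opposite
open AlgebraicGeometry.Scheme.Modules

universe u

namespace Literature.AlgebraicGeometry.Modules

open Literature.AlgebraicGeometry.Motives

variable {X Y : Scheme.{u}} (f : X ⟶ Y) {K : Type u} (τ : K → (X ⟶ X)) (hτ : ∀ x, τ x ≫ f = f)
  (M : Y.Modules)

/-- **The linearisation `(τ x)^* f^*M ≅ f^*M`** of a pulled-back module along a self-map `τ x` of `X` over `Y`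
(`(τ x)^* f^* ≅ (τ x ≫ f)^* = f^*`, Mathlib `pullbackComp` and `pullbackCongr`). [cite: MumfordAV1970, §7 Thm. 4 (p. 72) and §12 Thm. 1 (p. 111)] -/
def pullbackLinearisation (x : K) :
    (pullback (τ x)).obj ((pullback f).obj M) ≅ (pullback f).obj M :=
  (pullbackComp (τ x) f).app M ≪≫ (pullbackCongr (hτ x)).app M

/-- **The canonical action of `τ x` on `f_*f^*M`**: `f_*f^*M ⟶ f_*(τ x)_*(τ x)^*f^*M ≅ f_*(τ x)_* f^*M = (τ x ≫ f)_* f^*M = f_*f^*M`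
(unit of `(τ x)^* ⊣ (τ x)_*`, the linearisation, Mathlib `pushforwardComp ∕ pushforwardCongr`). On sections over `V ⊆ Y`:
`s ∈ Γ(f⁻¹V, f^*M) ↦ (τ x)^*s` read back in `Γ(f⁻¹V, f^*M)`. [cite: MumfordAV1970, §7 Thm. 4 (p. 72) and §12 Thm. 1 (p. 111)] -/
def twistAction (x : K) :
    (pushforward f).obj ((pullback f).obj M) ⟶ (pushforward f).obj ((pullback f).obj M) :=
  (pushforward f).map ((pullbackPushforwardAdjunction (τ x)).unit.app ((pullback f).obj M) ≫
      (pushforward (τ x)).map (pullbackLinearisation f τ hτ M x).hom) ≫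
    (pushforwardComp (τ x) f).hom.app ((pullback f).obj M) ≫ (pushforwardCongr (hτ x)).hom.app ((pullback f).obj M)

/-- **The action on a pulled-back section**: `act_x(c · η(m)) = σ_x(c) · η(m)` for `c ∈ Γ(f⁻¹V, 𝒪_X)`, `m ∈ Γ(V, M)`, where
`σ_x = (τ x)♯` on `Γ(f⁻¹V, 𝒪_X)` (`twistRingHom`). [cite: MumfordAV1970, §7 Thm. 4 (p. 72)] -/
theorem twistAction_app_smul_unitSection (x : K) (V : Y.Opens) (c : Γ(X, f ⁻¹ᵁ V)) (m : Γ(M, V)) :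
    (twistAction f τ hτ M x).app V (show Γ((pushforward f).obj ((pullback f).obj M), V) from c • unitSection f M V m) =
      (show Γ((pushforward f).obj ((pullback f).obj M), V) from twistRingHom f τ hτ V x c • unitSection f M V m) := by
  set N := (pullback f).obj M with hN
  -- unfold the action on sections: unit, linearisation, then the identity `f_*(τ x)_* = f_*` (a transport of opens)
  have step : (twistAction f τ hτ M x).app V (show Γ((pushforward f).obj N, V) from c • unitSection f M V m) =
      N.presheaf.map (eqToHom (preimage_preimage_eq f τ hτ x V).symm).op
        ((pullbackLinearisation f τ hτ M x).hom.app ((τ x) ⁻¹ᵁ (f ⁻¹ᵁ V))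
          (unitSection (τ x) N (f ⁻¹ᵁ V) (c • unitSection f M V m))) := by
    simp only [twistAction, Scheme.Modules.Hom.comp_app, CategoryTheory.comp_apply, pushforward_map_app,
      pushforwardComp_hom_app_app, pushforwardCongr_hom_app_app]
    rfl
  rw [step, unitSection_smul, Scheme.Modules.Hom.app_smul]
  -- the linearisation sends `η_{τ x}(η_f(m))` to `η_f(m)` transported along `(τ x ≫ f)⁻¹V = f⁻¹V`
  have lin : (pullbackLinearisation f τ hτ M x).hom.app ((τ x) ⁻¹ᵁ (f ⁻¹ᵁ V))
      (unitSection (τ x) N (f ⁻¹ᵁ V) (unitSection f M V m)) =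
      N.presheaf.map (eqToHom (preimage_preimage_eq f τ hτ x V)).op (unitSection f M V m) := by
    change ((pullbackCongr (hτ x)).hom.app M).app _ (((pullbackComp (τ x) f).hom.app M).app _
      (unitSection (τ x) N (f ⁻¹ᵁ V) (unitSection f M V m))) = _
    erw [pullbackComp_hom_app_unitSection f M (τ x) V m, pullbackCongr_hom_app_unitSection M (hτ x) V m]
    rfl
  rw [lin, Scheme.Modules.map_smul]
  have h1 : N.presheaf.map (eqToHom (preimage_preimage_eq f τ hτ x V).symm).op
      (N.presheaf.map (eqToHom (preimage_preimage_eq f τ hτ x V)).op (unitSection f M V m)) = unitSection f M V m := by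
    rw [← ConcreteCategory.comp_apply, ← Functor.map_comp, ← op_comp, eqToHom_trans, eqToHom_refl, op_id,
      CategoryTheory.Functor.map_id, ConcreteCategory.id_apply]
  have h2 : X.presheaf.map (eqToHom (preimage_preimage_eq f τ hτ x V).symm).op ((τ x).app (f ⁻¹ᵁ V) c) =
      twistRingHom f τ hτ V x c := by
    change _ = X.presheaf.map (homOfLE (preimage_preimage_eq f τ hτ x V).ge).op ((τ x).app (f ⁻¹ᵁ V) c)
    exact congrArg (fun j : f ⁻¹ᵁ V ⟶ (τ x) ⁻¹ᵁ (f ⁻¹ᵁ V) => X.presheaf.map j.op ((τ x).app (f ⁻¹ᵁ V) c))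
      (Subsingleton.elim _ _)
  change _ = twistRingHom f τ hτ V x c • unitSection f M V m
  rw [h1, h2]

/-- The action on a pulled-back section itself: `act_x(η(m)) = η(m)`. [cite: MumfordAV1970, §7 Thm. 4 (p. 72)] -/
theorem twistAction_app_unitSection (x : K) (V : Y.Opens) (m : Γ(M, V)) :
    (twistAction f τ hτ M x).app V (show Γ((pushforward f).obj ((pullback f).obj M), V) from unitSection f M V m) =
      (show Γ((pushforward f).obj ((pullback f).obj M), V) from unitSection f M V m) := by
  have h := twistAction_app_smul_unitSection f τ hτ M x V 1 m
  rw [map_one, one_smul] at h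
  exact h

/-- **The unit is invariant**: `η_M ≫ act_x = η_M` — sections pulled back from `Y` are fixed by the action of every self-map over `Y`.
[cite: MumfordAV1970, §7 Thm. 4 (p. 72) and §12 Thm. 1 (p. 111)] -/
theorem pullbackUnit_comp_twistAction (x : K) : pullbackUnit f M ≫ twistAction f τ hτ M x = pullbackUnit f M := by
  apply Scheme.Modules.hom_ext
  intro V
  ext m
  rw [Scheme.Modules.Hom.comp_app, ConcreteCategory.comp_apply]
  exact twistAction_app_unitSection f τ hτ M x V m

end Literature.AlgebraicGeometry.Modules
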